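import Mathlib
import Literature.Computability.AlgebraicComplexity.ArithCircuitProofs
import Literature.Computability.AlgebraicComplexity.DeterminantalIdealComplexityDescent
import HarnessLib

/-!
# Constant counting: low-support equations for polynomials of bounded circuit complexity

Topic `Literature/Computability/AlgebraicComplexity`. The "generic computation" argument of
Paterson–Stockmeyer / Heintz–Schnorr / Bürgisser–Clausen–Shokrollahi (BCS 1997, §9.1 and
Thm. (9.13)): a fan-in-two arithmetic circuit of size `s` (tree model `ArithCircuit`, sum gates
with coefficients, constant operands) carries at most `4s + 1` field constants; replacing the
constants by indeterminates gives, for each of the FINITELY many *skeletons* of size `≤ s`, a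
generic output polynomial whose coefficients are polynomials in `≤ 4s + 1` symbols; hence any
`K > 4s + 1` prescribed coefficients of the generic output are algebraically dependent
(transcendence degree), and the product over all skeletons of the resulting relations is ONE
nonzero polynomial in `K` variables vanishing at the chosen `K` coefficients of EVERY polynomial
of circuit complexity `≤ s`. Equivalently: the Zariski closure of the coefficient vectors of
`{f | L(f) ≤ s}` has dimension `≤ 4s + 1` (BCS Thm. (9.13): `dim W ≤` number of parameters, with
finitely many components, one per skeleton).

## Main statements

* `ArithCircuit.length_consts_le` — a fan-in-two circuit of size `s` has `≤ 4s + 1` constants.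
* `ArithCircuit.exists_equation_skeleton` — `T < K` symbols ⇒ a nonzero relation among any `K`
  coefficients of the generic evaluation, vanishing at every specialisation.
* `ArithCircuit.finite_skeletons` — finitely many skeletons of size `≤ s` over a finite alphabet of
  symbols and finitely many variables.
* `exists_equation_of_complexity_le` — for `4s + 1 < K` and ANY `K` exponent vectors `E`, a nonzero
  `D ∈ F[y_1, …, y_K]` with `D(coeff_{E 1} g, …, coeff_{E K} g) = 0` whenever `complexity g ≤ s`.

The constants / change-of-constants API (`ArithCircuit.consts`, `ArithCircuit.mapConsts`) is the
tree's (`DeterminantalIdealComplexityDescent.lean`); evaluation along a ring homomorphism is the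
tree's `ArithCircuit.eval_map_apply`.

WHAT THIS IS NOT: no degree bound on the equation `D` is claimed (BCS Thm. (9.13) also bounds
`deg W`; not formalised here), and nothing is said about computing `D` efficiently.

## References

* [BurgisserClausenShokrollahi1997] P. Bürgisser, M. Clausen, M. A. Shokrollahi, *Algebraic
  Complexity Theory*, Springer 1997, §9.1 (generic computations), Prop. (9.2), Thm. (9.13).
* [HeintzSchnorr1980] J. Heintz, C.-P. Schnorr, *Testing polynomials which are easy to compute*,
  STOC 1980, Basic Theorem (coefficient vectors of easy polynomials lie in a low-dimensional
  variety).

Lean text adapted from the cell `valiant-natproofs` planner seat p2 (gen 3), HOME/ConstantCount.lean.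
-/

noncomputable section

open MvPolynomial

namespace Literature.Computability.AlgebraicComplexity

namespace ArithCircuit

variable {k k' k'' : Type*} {σ : Type*}

/-! ### The number of constants of a fan-in-two circuit -/

/-- An operand carries at most one constant. [cite: BurgisserClausenShokrollahi1997, §9.1] -/
theorem Operand.length_consts_le (u : Operand k σ) : u.consts.length ≤ 1 := by
  cases u <;> simp [Operand.consts]

/-- A list of operands carries at most as many constants as it has entries.
[cite: BurgisserClausenShokrollahi1997, §9.1] -/
theorem length_flatMap_operandConsts_le (l : List (Operand k σ)) :
    (l.flatMap Operand.consts).length ≤ l.length := by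
  induction l with
  | nil => simp
  | cons a l ih =>
    rw [List.flatMap_cons, List.length_append, List.length_cons]
    have := Operand.length_consts_le a
    omega

/-- A gate of fan-in `φ` carries at most `2φ` constants (for a sum gate: one coefficient and at most
one constant operand per argument). [cite: BurgisserClausenShokrollahi1997, §9.1] -/
theorem Gate.length_consts_le (g : Gate k σ) : g.consts.length ≤ 2 * g.fanIn := by
  cases g with
  | sum args =>
    simp only [Gate.consts, List.length_append, List.length_map, Gate.fanIn, Gate.args]
    have h : (args.flatMap fun a => a.2.consts).length ≤ args.length := by
      have := length_flatMap_operandConsts_le (args.map Prod.snd)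
      rwa [List.flatMap_map, List.length_map] at this
    omega
  | prod args =>
    simp only [Gate.consts, Gate.fanIn, Gate.args]
    have := length_flatMap_operandConsts_le args
    omega

/-- **A fan-in-two circuit of size `s` has at most `4s + 1` constants** (the `(r+1)² + 1`
parameters of BCS's generic computation, in the tree's circuit model).
[cite: BurgisserClausenShokrollahi1997, §9.1] -/
theorem length_consts_le (P : ArithCircuit k σ) (hP : P.IsFanInTwo) :
    P.consts.length ≤ 4 * P.size + 1 := by
  have key : ∀ gs : List (Gate k σ), (∀ g ∈ gs, g.fanIn ≤ 2) →
      (gs.flatMap Gate.consts).length ≤ 4 * gs.length := by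
    intro gs hgs
    induction gs with
    | nil => simp
    | cons g gs ih =>
      rw [List.flatMap_cons, List.length_append, List.length_cons]
      have h1 := (Gate.length_consts_le g).trans (Nat.mul_le_mul_left 2 (hgs g (by simp)))
      have h2 := ih fun g' hg' => hgs g' (by simp [hg'])
      omega
  have hg := key P.gates hP
  have hout := Operand.length_consts_le P.output
  unfold consts size
  rw [List.length_append]
  omega

/-! ### Change of constants along plain maps (symbolic skeletons) -/

/-- Functoriality of `Operand.map`. [folklore] -/
private theorem Operand.map_map (φ : k → k') (ψ : k' → k'') (u : Operand k σ) :
    (u.map φ).map ψ = u.map (ψ ∘ φ) := by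
  cases u <;> rfl

/-- Functoriality of `Gate.map`. [folklore] -/
private theorem Gate.map_map (φ : k → k') (ψ : k' → k'') (g : Gate k σ) :
    (g.map φ).map ψ = g.map (ψ ∘ φ) := by
  cases g <;> simp [Gate.map, List.map_map, Function.comp_def, Operand.map_map]

/-- Functoriality of `mapConsts`. [folklore] -/
private theorem mapConsts_mapConsts (φ : k → k') (ψ : k' → k'') (P : ArithCircuit k σ) :
    (P.mapConsts φ).mapConsts ψ = P.mapConsts (ψ ∘ φ) := by
  simp [mapConsts, List.map_map, Function.comp_def, Gate.map_map, Operand.map_map]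

/-- If `ψ ∘ ρ` fixes every constant of `P`, then `P` is recovered from its skeleton `P.mapConsts ρ`
by `mapConsts ψ` (plain-map version of the tree's `map_mapConsts_eq_self`).
[cite: BurgisserClausenShokrollahi1997, §9.1] -/
theorem mapConsts_mapConsts_eq_self (ρ : k → k') (ψ : k' → k) (P : ArithCircuit k σ)
    (h : ∀ c ∈ P.consts, ψ (ρ c) = c) : (P.mapConsts ρ).mapConsts ψ = P := by
  obtain ⟨gates, output⟩ := P
  simp only [mapConsts, List.map_map, ArithCircuit.mk.injEq]
  constructor
  · conv_rhs => rw [← List.map_id gates]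
    refine List.map_congr_left fun g hg => ?_
    simp only [Function.comp_apply, id_eq]
    refine Gate.map_map_eq_self g fun c hc => h c ?_
    simp only [consts, List.mem_append, List.mem_flatMap]
    exact Or.inl ⟨g, hg, hc⟩
  · refine Operand.map_map_eq_self output fun c hc => h c ?_
    simp only [consts, List.mem_append]
    exact Or.inr hc

/-- `Gate.map` acts on the operand list by `Operand.map`. [folklore] -/
private theorem Gate.args_map (φ : k → k') (g : Gate k σ) :
    (g.map φ).args = g.args.map (Operand.map φ) := by
  cases g <;> simp [Gate.map, Gate.args, List.map_map, Function.comp_def]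

/-- `Operand.map` preserves the range of gate references. [folklore] -/
private theorem Operand.refsBelow_map (φ : k → k') {n : ℕ} {u : Operand k σ} (h : u.RefsBelow n) :
    (u.map φ) |>.RefsBelow n := by
  cases u with
  | var i => trivial
  | const c => trivial
  | gate j => exact h

/-- `RefsBelow` is monotone in the bound. [folklore] -/
private theorem Operand.refsBelow_of_le {m n : ℕ} (hmn : m ≤ n) {u : Operand k σ} (h : u.RefsBelow m) :
    u.RefsBelow n := by
  cases u with
  | var i => trivial
  | const c => trivial
  | gate j => exact lt_of_lt_of_le h hmn

/-- All gate references of a circuit (in its gates and its output) point below `s`; for a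
well-formed circuit of size `≤ s` this holds (`refsLT_of_wellFormed`). A finiteness device: with
it, skeletons of bounded size range over a finite set. [cite: BurgisserClausenShokrollahi1997, Thm. (9.13)] -/
def RefsLT (s : ℕ) (P : ArithCircuit k σ) : Prop :=
  (∀ g ∈ P.gates, ∀ u ∈ g.args, u.RefsBelow s) ∧ P.output.RefsBelow s

/-- A well-formed circuit of size `≤ s` has all references below `s`.
[cite: BurgisserClausenShokrollahi1997, Thm. (9.13)] -/
theorem refsLT_of_wellFormed {s : ℕ} {P : ArithCircuit k σ} (hwf : P.WellFormed)
    (hs : P.size ≤ s) : RefsLT s P := by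
  refine ⟨fun g hg u hu => ?_, Operand.refsBelow_of_le hs hwf.2⟩
  obtain ⟨i, hi, hig⟩ := List.getElem_of_mem hg
  have h1 := hwf.1 i g (by rw [← hig]; exact (List.getElem?_eq_getElem hi).symm ▸ rfl) u hu
  exact Operand.refsBelow_of_le (le_trans hi.le hs) h1

/-- `mapConsts` preserves `RefsLT`. [folklore] -/
private theorem refsLT_mapConsts (φ : k → k') {s : ℕ} {P : ArithCircuit k σ} (h : RefsLT s P) :
    RefsLT s (P.mapConsts φ) := by
  refine ⟨fun g hg u hu => ?_, Operand.refsBelow_map φ h.2⟩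
  simp only [mapConsts, List.mem_map] at hg
  obtain ⟨g₀, hg₀, rfl⟩ := hg
  rw [Gate.args_map, List.mem_map] at hu
  obtain ⟨u₀, hu₀, rfl⟩ := hu
  exact Operand.refsBelow_map φ (h.1 g₀ hg₀ u₀ hu₀)

section EvalMap

variable [CommSemiring k] [CommSemiring k']

/-- Along a ring homomorphism, `mapConsts` is the tree's change of scalars `ArithCircuit.map`
(definitionally). [folklore] -/
private theorem mapConsts_coe_ringHom (φ : k →+* k') (P : ArithCircuit k σ) :
    P.mapConsts φ = P.map φ := rfl

/-- Change of constants along a ring homomorphism maps the computed polynomial (the tree's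
`eval_map_apply`, restated for `mapConsts`). [cite: BurgisserClausenShokrollahi1997, §9.1] -/
theorem eval_mapConsts (φ : k →+* k') (P : ArithCircuit k σ) :
    (P.mapConsts φ).eval = MvPolynomial.map φ P.eval :=
  eval_map_apply φ P

end EvalMap

/-! ### Generic evaluation of a skeleton; few symbols force an equation -/

section Skeletons

variable {F : Type*} [Field F]

/-- The GENERIC EVALUATION of a symbolic skeleton (constants = symbols `j : Fin T`): its output
as a polynomial whose coefficients are polynomials in the symbols (BCS's `F_r = Σ_ν F_{rν} X^ν`
with `F_{rν} ∈ ℤ[a, b, c]`, here over `F`). [cite: BurgisserClausenShokrollahi1997, §9.1] -/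
def genericEval {T : ℕ} (sk : ArithCircuit (Fin T) σ) : MvPolynomial σ (MvPolynomial (Fin T) F) :=
  (sk.mapConsts fun j => (X j : MvPolynomial (Fin T) F)).eval

/-- Specialising the symbols to `c : Fin T → F` specialises the coefficients of the generic
evaluation. [cite: BurgisserClausenShokrollahi1997, §9.1] -/
theorem coeff_eval_mapConsts {T : ℕ} (sk : ArithCircuit (Fin T) σ) (c : Fin T → F) (m : σ →₀ ℕ) :
    coeff m (sk.mapConsts c).eval = MvPolynomial.eval c (coeff m (genericEval (F := F) sk)) := by
  have h1 : sk.mapConsts c =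
      (sk.mapConsts fun j => (X j : MvPolynomial (Fin T) F)).mapConsts (MvPolynomial.eval c) := by
    rw [mapConsts_mapConsts]
    congr 1
    funext j
    simp
  rw [h1, eval_mapConsts, coeff_map]
  rfl

/-- Evaluating after a substitution: `(D(q))(c) = D(q(c))`. [folklore] -/
private theorem eval_aeval_eq_eval {τ υ : Type*} (c : υ → F) (q : τ → MvPolynomial υ F)
    (D : MvPolynomial τ F) :
    MvPolynomial.eval c (aeval q D) = MvPolynomial.eval (fun j => MvPolynomial.eval c (q j)) D := by
  have key : (MvPolynomial.eval c).comp
      (aeval q : MvPolynomial τ F →ₐ[F] MvPolynomial υ F).toRingHom =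
      MvPolynomial.eval (fun j => MvPolynomial.eval c (q j)) :=
    MvPolynomial.ringHom_ext (fun a => by simp) (fun i => by simp)
  exact RingHom.congr_fun key D

/-- **Few symbols force an equation.** For `K > T` exponent vectors `E`, every skeleton with `T`
symbols admits a nonzero polynomial relation among the `K` chosen coefficients of its generic
evaluation (the transcendence degree of `F[c_1, …, c_T]` over `F` is `T`), and this relation
vanishes at the corresponding coefficients of every specialisation of the skeleton.
[cite: BurgisserClausenShokrollahi1997, §9.1, proof of Prop. (9.2)] -/
theorem exists_equation_skeleton {T K : ℕ} (hTK : T < K) (sk : ArithCircuit (Fin T) σ)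
    (E : Fin K → (σ →₀ ℕ)) :
    ∃ D : MvPolynomial (Fin K) F, D ≠ 0 ∧
      ∀ c : Fin T → F, MvPolynomial.eval (fun i => coeff (E i) (sk.mapConsts c).eval) D = 0 := by
  classical
  let q : Fin K → MvPolynomial (Fin T) F := fun i => coeff (E i) (genericEval (F := F) sk)
  have hdep : ¬ AlgebraicIndependent F q := by
    intro hind
    have hcard := hind.lift_cardinalMk_le_trdeg
    simp only [MvPolynomial.trdeg_of_isDomain, Cardinal.mk_fin, Cardinal.lift_natCast,
      Nat.cast_le] at hcard
    omega
  rw [algebraicIndependent_iff] at hdep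
  obtain ⟨D, hD⟩ := not_forall.mp hdep
  obtain ⟨hD0, hDne⟩ := Classical.not_imp.mp hD
  refine ⟨D, hDne, fun c => ?_⟩
  have hpt : (fun i => coeff (E i) (sk.mapConsts c).eval) = fun i => MvPolynomial.eval c (q i) := by
    funext i; exact coeff_eval_mapConsts sk c (E i)
  rw [hpt, ← eval_aeval_eq_eval c q D, hD0, map_zero]

/-- **Symbols for the constants.** A circuit with at most `T` constants (`0 < T`) is a
specialisation `(P.mapConsts ψ).mapConsts c` of a skeleton over the alphabet `Fin T` with the same
gates (hence the same size, fan-in and references). [cite: BurgisserClausenShokrollahi1997, §9.1] -/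
theorem exists_skeleton {T : ℕ} (hT : 0 < T) (P : ArithCircuit F σ) (hlen : P.consts.length ≤ T) :
    ∃ ψ : F → Fin T, ∃ c : Fin T → F, (P.mapConsts ψ).mapConsts c = P := by
  classical
  let S : Finset F := P.consts.toFinset
  have hS : S.card ≤ T := le_trans (List.toFinset_card_le _) hlen
  let ψ : F → Fin T := fun x =>
    if h : x ∈ S then Fin.castLE hS (S.equivFin ⟨x, h⟩) else ⟨0, hT⟩
  have hinj : Set.InjOn ψ (S : Set F) := by
    intro x hx y hy hxy
    have hx' : x ∈ S := hx
    have hy' : y ∈ S := hy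
    simp only [ψ, dif_pos hx', dif_pos hy'] at hxy
    have := S.equivFin.injective (Fin.castLE_injective hS hxy)
    exact congrArg Subtype.val this
  refine ⟨ψ, Function.invFunOn ψ (S : Set F), ?_⟩
  exact mapConsts_mapConsts_eq_self ψ _ P fun x hx =>
    hinj.leftInvOn_invFunOn (List.mem_toFinset.mpr hx)

variable (σ) in
/-- The skeletons over the alphabet `Fin T` of size `≤ s`, fan-in two, with all references below
`s` (BCS's finitely many "types" `η ∈ {0,1}^r` of a computation of length `r`).
[cite: BurgisserClausenShokrollahi1997, Thm. (9.13)] -/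
def Skeletons (s T : ℕ) : Set (ArithCircuit (Fin T) σ) :=
  {sk | sk.size ≤ s ∧ sk.IsFanInTwo ∧ RefsLT s sk}

/-- Lists of bounded length with entries in a finite set form a finite set. [folklore] -/
private theorem finite_setOf_lists_of_finite {α : Type*} {S : Set α} (hS : S.Finite) (n : ℕ) :
    {l : List α | l.length ≤ n ∧ ∀ x ∈ l, x ∈ S}.Finite := by
  haveI := hS.to_subtype
  refine ((List.finite_length_le S n).image (List.map Subtype.val)).subset fun l hl => ?_
  obtain ⟨hlen, hmem⟩ := hl
  refine ⟨l.attach.map fun x => ⟨x.1, hmem x.1 x.2⟩, by simpa using hlen, ?_⟩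
  rw [List.map_map]
  exact l.attach_map_val.trans (List.map_id _)

/-- **Finitely many skeletons** of size `≤ s` over `Fin T` in finitely many variables.
[cite: BurgisserClausenShokrollahi1997, Thm. (9.13)] -/
theorem finite_skeletons [Finite σ] (s T : ℕ) : (Skeletons σ s T).Finite := by
  -- operands with references below `s`
  let O : Set (Operand (Fin T) σ) := {u | u.RefsBelow s}
  have hO : O.Finite := by
    refine ((Set.finite_range Operand.var).union ((Set.finite_range Operand.const).union
      ((Set.finite_lt_nat s).image Operand.gate))).subset fun u hu => ?_
    cases u with
    | var i => exact Or.inl ⟨i, rfl⟩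
    | const c => exact Or.inr (Or.inl ⟨c, rfl⟩)
    | gate j => exact Or.inr (Or.inr ⟨j, hu, rfl⟩)
  -- gates of fan-in ≤ 2 with operands in `O`
  let G : Set (Gate (Fin T) σ) := {g | g.fanIn ≤ 2 ∧ ∀ u ∈ g.args, u ∈ O}
  have hA : {l : List (Fin T × Operand (Fin T) σ) | l.length ≤ 2 ∧
      ∀ a ∈ l, a ∈ (Set.univ : Set (Fin T)) ×ˢ O}.Finite :=
    finite_setOf_lists_of_finite ((Set.finite_univ).prod hO) 2
  have hB : {l : List (Operand (Fin T) σ) | l.length ≤ 2 ∧ ∀ u ∈ l, u ∈ O}.Finite :=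
    finite_setOf_lists_of_finite hO 2
  have hG : G.Finite := by
    refine ((hA.image Gate.sum).union (hB.image Gate.prod)).subset fun g hg => ?_
    obtain ⟨hfan, hops⟩ := hg
    cases g with
    | sum args =>
      refine Or.inl ⟨args, ⟨?_, fun a ha => ⟨Set.mem_univ _, hops a.2 ?_⟩⟩, rfl⟩
      · simpa [Gate.fanIn, Gate.args] using hfan
      · simp only [Gate.args, List.mem_map]
        exact ⟨a, ha, rfl⟩
    | prod args =>
      refine Or.inr ⟨args, ⟨?_, fun u hu => hops u ?_⟩, rfl⟩
      · simpa [Gate.fanIn, Gate.args] using hfan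
      · simpa [Gate.args] using hu
  have hC : {l : List (Gate (Fin T) σ) | l.length ≤ s ∧ ∀ g ∈ l, g ∈ G}.Finite :=
    finite_setOf_lists_of_finite hG s
  refine ((hC.prod hO).image fun q => (⟨q.1, q.2⟩ : ArithCircuit (Fin T) σ)).subset
    fun sk hsk => ?_
  obtain ⟨hsize, hfan, hrefs⟩ := hsk
  refine ⟨(sk.gates, sk.output), ⟨⟨hsize, fun g hg => ⟨hfan g hg, fun u hu => hrefs.1 g hg u hu⟩⟩,
    hrefs.2⟩, rfl⟩

end Skeletons

end ArithCircuit

/-! ### The equation for a complexity class -/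

open ArithCircuit in
/-- **Low-support equations for polynomials of bounded circuit complexity** (constant count /
generic computation). Over a field `F`, for every `s` and every family `E` of `K > 4s + 1`
exponent vectors in finitely many variables `σ`, there is a nonzero `D ∈ F[y_1, …, y_K]` (no
degree bound claimed) with `D(coeff_{E 1} g, …, coeff_{E K} g) = 0` for EVERY `g ∈ F[X_σ]` of
fan-in-two circuit complexity `complexity g ≤ s`. Equivalently: the Zariski closure of the
coefficient vectors of `{g | L(g) ≤ s}` has dimension `≤ 4s + 1` — it projects to a proper
subvariety of every coordinate subspace of dimension `4s + 2`. Proof: `≤ 4s + 1` constants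
(`length_consts_le`), finitely many skeletons (`finite_skeletons`), one relation per skeleton by
transcendence degree (`exists_equation_skeleton`), and their product.
[cite: BurgisserClausenShokrollahi1997, §9.1 and Thm. (9.13)] -/
theorem exists_equation_of_complexity_le {F : Type*} [Field F] {σ : Type*} [Finite σ] (s : ℕ)
    {K : ℕ} (hK : 4 * s + 1 < K) (E : Fin K → (σ →₀ ℕ)) :
    ∃ D : MvPolynomial (Fin K) F, D ≠ 0 ∧
      ∀ g : MvPolynomial σ F, complexity g ≤ s → eval (fun i => coeff (E i) g) D = 0 := by
  classical
  set T := 4 * s + 1 with hT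
  have hfin := finite_skeletons (σ := σ) s T
  choose Dsk hDne hDvan using
    fun sk : ArithCircuit (Fin T) σ => exists_equation_skeleton (F := F) hK sk E
  refine ⟨∏ sk ∈ hfin.toFinset, Dsk sk, Finset.prod_ne_zero_iff.mpr fun sk _ => hDne sk,
    fun g hg => ?_⟩
  -- a well-formed fan-in-two circuit of size ≤ s for g, and its skeleton
  obtain ⟨P, hP2, hPg, hPs⟩ := exists_computes_size_eq_complexity g
  obtain ⟨Q, hQwf, hQg, hQs, hQ2, -⟩ := exists_wellFormed_of_computes_holds hPg
  have hQ2' : Q.IsFanInTwo := hQ2 hP2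
  have hQsize : Q.size ≤ s := by rw [hQs, hPs]; exact hg
  have hlen : Q.consts.length ≤ T := (length_consts_le Q hQ2').trans (by omega)
  obtain ⟨ψ, c, hQ⟩ := exists_skeleton (by omega) Q hlen
  have hsk : Q.mapConsts ψ ∈ hfin.toFinset := by
    rw [Set.Finite.mem_toFinset]
    exact ⟨by rw [size_mapConsts]; exact hQsize, hQ2'.mapConsts ψ,
      refsLT_mapConsts ψ (refsLT_of_wellFormed hQwf hQsize)⟩
  rw [map_prod]
  refine Finset.prod_eq_zero hsk ?_
  have hgQ : g = ((Q.mapConsts ψ).mapConsts c).eval := by rw [hQ]; exact hQg.symm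
  rw [hgQ]
  exact hDvan (Q.mapConsts ψ) c

/-- Corollary in "hitting" language: for `4s + 1 < K`, the coefficient vectors of
`{g | complexity g ≤ s}` restricted to any `K` coordinates `E` are annihilated by a nonzero
polynomial — so no class of polynomials of complexity `≤ s` is dense in any `(4s+2)`-dimensional
coordinate projection. [cite: BurgisserClausenShokrollahi1997, Thm. (9.13)] -/
theorem exists_equation_of_complexity_le' {F : Type*} [Field F] {σ : Type*} [Finite σ] (s : ℕ)
    {K : ℕ} (hK : 4 * s + 2 ≤ K) (E : Fin K → (σ →₀ ℕ)) :
    ∃ D : MvPolynomial (Fin K) F, D ≠ 0 ∧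
      ∀ g : MvPolynomial σ F, complexity g ≤ s → eval (fun i => coeff (E i) g) D = 0 :=
  exists_equation_of_complexity_le s (by omega) E

end Literature.Computability.AlgebraicComplexity

end
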